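import Summits.HodgeConjecture.HodgeConjecture.Cruxes.BlochSeedDiscOne.PortHallLegSurplus
import Summits.HodgeConjecture.HodgeConjecture.Cruxes.BlochSeedDiscOne.PatternedPorteous

/-!
# ROW-α2 follow-up (R19.859 (Q1) debt, memo v1.2 §4bis) — the one-column SLOT-RANK row `HallPlusRhoUp` (negation g26)

Companion to `PortHallLegSurplus.lean` (LEG row) and `PatternedPorteous.lean` (LAW PP).  Memo v1.2 §4bis
(`Cruxes/BlochSeedDiscOne/PORTHALL8-ROW-A2-negation-g26.md` 44470fee57e9ddae) proves WITH THE PEN: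

* THEOREM B (RHO LAW).  For a P-entry `σ` of multiplicity `m` with weakly-live receivers `Γ(σ)` of total mass `N`, let `ρ(σ)` be the
  largest number of receiver COPIES that can be «slotted»: each copy is assigned ONE of its leg factors (a factor where `σ_f ≠ τ_f`), at most
  two copies per factor, never two copies whose steps at that factor are proportional NULL classes.  Then `PPClean weakB D` implies
  `m + ρ(σ) ≤ N` for every P-entry, and for a one-sender design this is an equivalence.  (No-cancellation: the top Chern digit is a sum of
  products of nef step classes, non-zero iff a slotting exists — Hodge index on `E₀²`; slottings = independent partial transversals of a sum of
  rank-2 truncations, Rado–Hall [Handbook of Combinatorics vol. 1, ch. 9, Thm 9.7].)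
* THEOREM A.  `ρ(σ) ≥ min(N, d_min(σ))`, hence RHO ⟹ every one-column instance of the LEG row: one-column `HallPlusLegUp`-kills owe nothing
  under R19.859 (Q1); only multi-column kills still owe the Chern digit ((MS), open; 0 ∕ 3 566 numerical counterexamples).

THIS FILE types the slot rank as a COMPUTABLE function (`slotBest`, exhaustive search) and the row `HallPlusRhoUp`, and certifies by `decide`
the §4bis readings on toys: (1) monad-3's `MIXB` (bus l.9857: LEG-feasible, PP-dirty) FAILS the RHO row (`ρ = 3 > s = 2`) while it PASSES the
LEG row — so LEG is strictly weaker than PP already on ONE-column sets and RHO closes exactly that gap there; (2) `MIXA` passes RHO (PP-clean);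
(3) the memo's mixed example `DMIX` (σ under τ₁ × 2 ample on factor 0 only and τ₂ × 2 ample on factor 1 only): LEG passes, RHO fails (`ρ = 4`),
PP dirty; its partner `DMIX2` (receivers × 3, senders × 2) passes RHO and is PP-clean; (4) `C1` ∕ `C2` of `PortHallLegSurplus` pass RHO with
`ρ = d_min` (uniform legs, T3); (5) the HODGE-INDEX CLAUSE: `DNULA` (two NON-proportional null legs on one factor: `ρ = 2`, RHO fails, PP dirty)
versus `DNULB` (two PROPORTIONAL null legs: `ρ = 1`, RHO holds, PP clean) — the LEG row passes both, so leg DIMENSIONS alone cannot see it.  Theorems A ∕ B themselves are NOT formalised here (pen, memo §4bis); nothing in this file is a theorem about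
sheaves.  HONEST: letters ≠ sheaves ≠ SEED; nothing here proves 18881 ∕ H2 ∕ HC_AV ∕ HC_CM ∕ HC.  0 sorry · 0 axiom · no `instance` ∕ `notation` ∕ new inductive.
-/

set_option linter.dupNamespace false
set_option autoImplicit false
set_option maxRecDepth 16384
set_option maxHeartbeats 8000000

namespace Summit.HodgeConjecture.HodgeConjecture.Cruxes.BlochSeedDiscOne.PortHallRho

open Summit.HodgeConjecture.HodgeConjecture.Cruxes.BlochSeedDiscOne.DepthBoundA4
open Summit.HodgeConjecture.HodgeConjecture.Cruxes.BlochSeedDiscOne.LeggedFloor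
open Summit.HodgeConjecture.HodgeConjecture.Cruxes.BlochSeedDiscOne.HallB136
open Summit.HodgeConjecture.HodgeConjecture.Cruxes.BlochSeedDiscOne.RuleDPlate
open Summit.HodgeConjecture.HodgeConjecture.Cruxes.BlochSeedDiscOne.PortHallLeg
open Summit.HodgeConjecture.HodgeConjecture.Cruxes.BlochSeedDiscOne.PatternedPorteous

/-! ## §1 Step kinds, leg options of a receiver copy, slot rank -/

/-- kind of a non-equal factor step `ℓ → ℓ'`, encoded WITHOUT a new inductive (no `instance` declarations in crux workfiles): `none` =
AMPLE; `some (Δa, Δx, Δy)` = NULL with its difference vector (needed to test proportionality of two null classes).  (Only used on not-dead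
steps; on a dead non-null step the value AMPLE is meaningless and never consulted by the row.) -/
abbrev StepKind := Option (ℤ × ℤ × ℤ)

/-- the step kind of `ℓ → ℓ'`; the OUTER `none` means the letters are equal (no leg at this factor). -/
def stepKind (ℓ ℓ' : Letter) : Option StepKind :=
  if ℓ = ℓ' then none
  else if (ℓ'.x - ℓ.x) ^ 2 + (ℓ'.y - ℓ.y) ^ 2 = (ℓ'.a - ℓ.a) ^ 2 then some (some (ℓ'.a - ℓ.a, ℓ'.x - ℓ.x, ℓ'.y - ℓ.y))
  else some none

/-- the leg options of a copy of `τ` under the sender `σ`: its leg factors with their step kinds. -/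
def legOpts (σ τ : Cell) : List (Fin 4 × StepKind) :=
  [0, 1, 2, 3].filterMap fun f => (stepKind (σ f) (τ f)).map fun k => (f, k)

/-- two step kinds are PROPORTIONAL NULLS (same null direction on the factor `E₀²`; such a pair of nef classes has product zero). -/
def propNull : StepKind → StepKind → Bool
  | some (a, x, y), some (a', x', y') => a * x' == a' * x && a * y' == a' * y && x * y' == x' * y
  | _, _ => false

/-- a copy of kind `k` may join the classes already placed on a factor: at most two per factor, no proportional null pair. -/
def compat (placed : List StepKind) (k : StepKind) : Bool :=
  decide (placed.length < 2) && placed.all fun k' => !propNull k' k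

/-- **slot rank** by exhaustive search: the largest number of copies (each given by its option list) that can be slotted on top of the
placement state `st`. -/
def slotBest : List (List (Fin 4 × StepKind)) → (Fin 4 → List StepKind) → ℕ
  | [], _ => 0
  | opts :: rest, st =>
      (opts.map fun fk => if compat (st fk.1) fk.2 then slotBest rest (Function.update st fk.1 (fk.2 :: st fk.1)) + 1 else 0).foldr
        max (slotBest rest st)

/-- the weakly-live receiver entries `Γ(σ)` of a sender cell in a design (raw Bool test `weakLiveB`, sound by
`PortHallLeg.weakLive_of_weakLiveB` ∕ `HallB136.weakLiveB_of`). -/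
def gammaOf (E : Design) (σ : Cell) : List (Cell × ℕ) := E.N.filter fun cn => weakLiveB σ cn.1

/-- receiver mass `N = Σ_{Γ(σ)} n`. -/
def massGamma (E : Design) (σ : Cell) : ℕ := ((gammaOf E σ).map Prod.snd).sum

/-- the option lists of all receiver copies of `σ` (a receiver of multiplicity `n` contributes `n` identical copies). -/
def copiesOf (E : Design) (σ : Cell) : List (List (Fin 4 × StepKind)) :=
  (gammaOf E σ).flatMap fun cn => List.replicate cn.2 (legOpts σ cn.1)

/-- **`ρ(σ)`**, the slot rank of the sender `σ` in `E`. -/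
def rho (E : Design) (σ : Cell) : ℕ := slotBest (copiesOf E σ) fun _ => []

/-! ## §2 The row -/

/-- **SLOT-RANK ROW `HallPlusRhoUp`** (memo v1.2 §4bis THEOREM B, necessary under LAW PP; exact on one-column sets): every P-entry `σ` of
positive multiplicity `m` satisfies `m + ρ(σ) ≤ Σ_{Γ(σ)} n`. -/
def HallPlusRhoUp (E : Design) : Prop :=
  ∀ cm ∈ E.P, 0 < cm.2 → cm.2 + rho E cm.1 ≤ massGamma E cm.1

/-! ## §3 Toys (all by `decide`; PP values by monad-3's engine `ppCleanB weakB`) -/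

/-- monad-3's MIX-B (`x3` ×1 under `y3` ×2 (one ample leg, factor 3) and `hub7` ×1 (four-ample)): `ρ = 3`, receiver mass `3`. -/
theorem rho_MIXB : rho MIXB x3 = 3 ∧ massGamma MIXB x3 = 3 := by decide

/-- … so MIX-B FAILS the RHO row (`1 + 3 > 3`), in agreement with `PatternedPorteous.mixB` (PP-dirty). -/
theorem not_hallPlusRhoUp_MIXB : ¬ HallPlusRhoUp MIXB := by
  unfold HallPlusRhoUp
  decide

theorem MIXA_pp : ppCleanB weakB MIXA = true := by decide +kernel

/-- MIX-A (`y3` ×3, `hub7` ×2): `ρ = 4 ≤ 5 − 1`, the row HOLDS, in agreement with `PatternedPorteous.mixA` ∕ `MIXA_pp` (PP-clean). -/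
theorem hallPlusRhoUp_MIXA : rho MIXA x3 = 4 ∧ HallPlusRhoUp MIXA := by
  unfold HallPlusRhoUp
  exact ⟨by decide, by decide⟩

/-- sub-lists of a two-element list. -/
theorem sublist_pair {α : Type} {T : List α} {a b : α} (h : T.Sublist [a, b]) :
    T = [] ∨ T = [a] ∨ T = [b] ∨ T = [a, b] := by
  have := List.mem_sublists.mpr h
  simp [List.sublists] at this
  tauto

/-- sub-lists of a singleton. -/
theorem sublist_single {α : Type} {S : List α} {a : α} (h : S.Sublist [a]) : S = [] ∨ S = [a] := by
  have := List.mem_sublists.mpr h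
  simp [List.sublists] at this
  tauto

theorem weakLive_x3_y3 : WeakLive x3 y3 := weakLive_of_weakLiveB (by decide)
theorem weakLive_x3_hub7 : WeakLive x3 hub7 := weakLive_of_weakLiveB (by decide)
theorem pairDim_x3 : pairDim x3 y3 = 2 ∧ pairDim x3 hub7 = 8 := by decide

/-- … while MIX-B PASSES the LEG row (`d_min = 2`, `1 + 2 ≤ 3`): LEG is strictly weaker than PP on a ONE-column set. -/
theorem hallPlusLegUp_MIXB : HallPlusLegUp MIXB := by
  intro S hS hpos T hT hcov d _ hd
  rcases sublist_single hS with rfl | rfl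
  · simp at hpos
  · have hy : (y3, 2) ∈ T := hcov _ (by simp [MIXB]) ⟨(x3, 1), by simp, weakLive_x3_y3⟩
    have hh : (hub7, 1) ∈ T := hcov _ (by simp [MIXB]) ⟨(x3, 1), by simp, weakLive_x3_hub7⟩
    have hd2 : d ≤ 2 := by simpa [pairDim_x3.1] using hd (x3, 1) (by simp) (y3, 2) hy weakLive_x3_y3
    rcases sublist_pair hT with rfl | rfl | rfl | rfl
    · simp at hy
    · exact absurd (Prod.mk.inj (List.mem_singleton.mp hh)).2 (by decide)
    · exact absurd (Prod.mk.inj (List.mem_singleton.mp hy)).2 (by decide)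
    · simp
      omega

/-- **SEPARATION ON A ONE-COLUMN SET**: MIX-B passes LEG, fails RHO, and is PP-dirty. -/
theorem MIXB_pp : ppCleanB weakB MIXB = false := by decide +kernel

theorem rho_row_separates_MIXB : HallPlusLegUp MIXB ∧ ¬ HallPlusRhoUp MIXB ∧ ¬ PPClean weakB MIXB :=
  ⟨hallPlusLegUp_MIXB, not_hallPlusRhoUp_MIXB, by simp [PPClean, MIXB_pp]⟩

/-- the memo's mixed example at height 7: `σ = (3;2,2)⁴`, `τ₁` ample above `σ` on factor 0 only, `τ₂` on factor 1 only. -/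
def sig : Cell := PatternedPorteous.cellOf lL lL lL lL
/-- `τ₁`. -/ def tauA : Cell := PatternedPorteous.cellOf l7 lL lL lL
/-- `τ₂`. -/ def tauB : Cell := PatternedPorteous.cellOf lL l7 lL lL
/-- DMIX: `σ ×1` under `τ₁ ×2`, `τ₂ ×2`. -/
def DMIX : Design := ⟨[(tauA, 2), (tauB, 2)], [(sig, 1)]⟩
/-- DMIX2: `σ ×2` under `τ₁ ×3`, `τ₂ ×3`. -/
def DMIX2 : Design := ⟨[(tauA, 3), (tauB, 3)], [(sig, 2)]⟩

theorem weakLive_sig : WeakLive sig tauA ∧ WeakLive sig tauB :=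
  ⟨weakLive_of_weakLiveB (by decide), weakLive_of_weakLiveB (by decide)⟩
theorem pairDim_sig : pairDim sig tauA = 2 ∧ pairDim sig tauB = 2 := by decide

/-- DMIX: `ρ = 4` (two copies on factor 0, two on factor 1) against receiver mass `4`: the RHO row FAILS, PP is dirty … -/
theorem DMIX_pp : ppCleanB weakB DMIX = false := by decide +kernel

theorem DMIX_rho : rho DMIX sig = 4 ∧ ¬ HallPlusRhoUp DMIX ∧ ¬ PPClean weakB DMIX := by
  refine ⟨by decide, ?_, by simp [PPClean, DMIX_pp]⟩
  unfold HallPlusRhoUp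
  decide

/-- … while the LEG row holds (`1 + d_min = 3 ≤ 4`). -/
theorem hallPlusLegUp_DMIX : HallPlusLegUp DMIX := by
  intro S hS hpos T hT hcov d _ hd
  rcases sublist_single hS with rfl | rfl
  · simp at hpos
  · have hA : (tauA, 2) ∈ T := hcov _ (by simp [DMIX]) ⟨(sig, 1), by simp, weakLive_sig.1⟩
    have hB : (tauB, 2) ∈ T := hcov _ (by simp [DMIX]) ⟨(sig, 1), by simp, weakLive_sig.2⟩
    have hd2 : d ≤ 2 := by simpa [pairDim_sig.1] using hd (sig, 1) (by simp) (tauA, 2) hA weakLive_sig.1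
    rcases sublist_pair hT with rfl | rfl | rfl | rfl
    · simp at hA
    · exact absurd (congrFun (Prod.mk.inj (List.mem_singleton.mp hB)).1 0) (by decide)
    · exact absurd (congrFun (Prod.mk.inj (List.mem_singleton.mp hA)).1 0) (by decide)
    · simp
      omega

/-- DMIX2 (one more copy of each receiver, one more sender copy): `ρ = 4 ≤ 6 − 2`, RHO holds and PP is clean — the law `m ≤ N − ρ` is
attained. -/
theorem DMIX2_pp : ppCleanB weakB DMIX2 = true := by decide +kernel

theorem DMIX2_rho : rho DMIX2 sig = 4 ∧ HallPlusRhoUp DMIX2 ∧ PPClean weakB DMIX2 := by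
  refine ⟨by decide, ?_, DMIX2_pp⟩
  unfold HallPlusRhoUp
  decide

/-- uniform legs (T3): `C1` (null leg, `ρ = 1 = d_min`) and `C2` (one ample leg, `ρ = 2 = d_min`) pass RHO exactly as they pass LEG. -/
theorem rho_C1_C2 : rho C1 sigma1 = 1 ∧ HallPlusRhoUp C1 ∧ rho C2 sigma2 = 2 ∧ HallPlusRhoUp C2 := by
  unfold HallPlusRhoUp
  exact ⟨by decide, by decide, by decide, by decide⟩

/-- scope guards of the new toys (F6: height-7 alphabet, disjoint supports). -/
theorem DMIX_scope : DMIX.OnAlphabet 7 ∧ Disj DMIX ∧ DMIX2.OnAlphabet 7 ∧ Disj DMIX2 := by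
  refine ⟨?_, ?_, ?_, ?_⟩
  · intro c hc f
    have hc' : c = tauA ∨ c = tauB ∨ c = sig := by simpa [DMIX, Design.suppN, Design.suppP] using hc
    rcases hc' with rfl | rfl | rfl <;> fin_cases f <;> exact ⟨by decide, by decide⟩
  · intro c hN hP
    have h1 : c = tauA ∨ c = tauB := by simpa [DMIX, Design.suppN] using hN
    have h2 : c = sig := by simpa [DMIX, Design.suppP] using hP
    rcases h1 with rfl | rfl
    · exact absurd (congrFun h2 0) (by decide)
    · exact absurd (congrFun h2 1) (by decide)
  · intro c hc f
    have hc' : c = tauA ∨ c = tauB ∨ c = sig := by simpa [DMIX2, Design.suppN, Design.suppP] using hc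
    rcases hc' with rfl | rfl | rfl <;> fin_cases f <;> exact ⟨by decide, by decide⟩
  · intro c hN hP
    have h1 : c = tauA ∨ c = tauB := by simpa [DMIX2, Design.suppN] using hN
    have h2 : c = sig := by simpa [DMIX2, Design.suppP] using hP
    rcases h1 with rfl | rfl
    · exact absurd (congrFun h2 0) (by decide)
    · exact absurd (congrFun h2 1) (by decide)

/-! ## §4 The Hodge-index clause on a toy: proportional versus non-proportional null legs -/

/-- null receivers of the letter `lL = (3;2,2)` at height 7: `lP = (4;1,2)` (step `(1;−1,0)`), `lQ = (4;2,1)` (step `(1;0,−1)`, NOT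
proportional to the first) and `lR = (5;0,2)` (step `(2;−2,0)`, proportional to the first). -/
def lQ : Letter := ⟨4, 2, 1⟩
/-- `(5;0,2)`. -/ def lR : Letter := ⟨5, 0, 2⟩
/-- receiver with null leg `lL → lP` on factor 3. -/ def rP : Cell := PatternedPorteous.cellOf lL lL lL lP
/-- receiver with null leg `lL → lQ` on factor 3. -/ def rQ : Cell := PatternedPorteous.cellOf lL lL lL lQ
/-- receiver with null leg `lL → lR` on factor 3. -/ def rR : Cell := PatternedPorteous.cellOf lL lL lL lR
/-- DNULA: `σ ×1` under two receivers with NON-proportional null legs on the same factor. -/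
def DNULA : Design := ⟨[(rP, 1), (rQ, 1)], [(sig, 1)]⟩
/-- DNULB: `σ ×1` under two receivers with PROPORTIONAL null legs on the same factor. -/
def DNULB : Design := ⟨[(rP, 1), (rR, 1)], [(sig, 1)]⟩

theorem DNUL_steps : NullStep (sig 3) (rP 3) ∧ NullStep (sig 3) (rQ 3) ∧ NullStep (sig 3) (rR 3) :=
  ⟨⟨by decide, by decide⟩, ⟨by decide, by decide⟩, ⟨by decide, by decide⟩⟩
theorem weakLive_DNUL : WeakLive sig rP ∧ WeakLive sig rQ ∧ WeakLive sig rR :=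
  ⟨weakLive_of_weakLiveB (by decide), weakLive_of_weakLiveB (by decide), weakLive_of_weakLiveB (by decide)⟩
theorem pairDim_DNUL : pairDim sig rP = 1 ∧ pairDim sig rQ = 1 ∧ pairDim sig rR = 1 := by decide

theorem DNULA_pp : ppCleanB weakB DNULA = false := by decide +kernel
theorem DNULB_pp : ppCleanB weakB DNULB = true := by decide +kernel

/-- DNULA: the two null classes are not proportional, both copies slot on factor 3, `ρ = 2 > s = 1`: RHO FAILS and PP is dirty (the product
of two non-proportional null nef classes on `E₀²` is positive — Hodge index). -/
theorem DNULA_rho : rho DNULA sig = 2 ∧ ¬ HallPlusRhoUp DNULA ∧ ¬ PPClean weakB DNULA := by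
  refine ⟨by decide, ?_, by simp [PPClean, DNULA_pp]⟩
  unfold HallPlusRhoUp
  decide

/-- DNULB: proportional null classes cannot share the factor, `ρ = 1 = s`: RHO HOLDS and PP is clean (their product vanishes). -/
theorem DNULB_rho : rho DNULB sig = 1 ∧ HallPlusRhoUp DNULB ∧ PPClean weakB DNULB := by
  refine ⟨by decide, ?_, DNULB_pp⟩
  unfold HallPlusRhoUp
  decide

/-- … and the LEG row cannot tell DNULA from DNULB (`d_min = 1`, `1 + 1 ≤ 2` in both): it PASSES the PP-dirty DNULA — a second kind of
one-column separation, invisible to leg DIMENSIONS and visible to the slot rank. -/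
theorem hallPlusLegUp_DNULA : HallPlusLegUp DNULA := by
  intro S hS hpos T hT hcov d _ hd
  rcases sublist_single hS with rfl | rfl
  · simp at hpos
  · have hA : (rP, 1) ∈ T := hcov _ (by simp [DNULA]) ⟨(sig, 1), by simp, weakLive_DNUL.1⟩
    have hB : (rQ, 1) ∈ T := hcov _ (by simp [DNULA]) ⟨(sig, 1), by simp, weakLive_DNUL.2.1⟩
    have hd1 : d ≤ 1 := by simpa [pairDim_DNUL.1] using hd (sig, 1) (by simp) (rP, 1) hA weakLive_DNUL.1
    rcases sublist_pair hT with rfl | rfl | rfl | rfl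
    · simp at hA
    · exact absurd (congrFun (Prod.mk.inj (List.mem_singleton.mp hB)).1 3) (by decide)
    · exact absurd (congrFun (Prod.mk.inj (List.mem_singleton.mp hA)).1 3) (by decide)
    · simp
      omega

theorem DNUL_scope : DNULA.OnAlphabet 7 ∧ Disj DNULA ∧ DNULB.OnAlphabet 7 ∧ Disj DNULB := by
  refine ⟨?_, ?_, ?_, ?_⟩
  · intro c hc f
    have hc' : c = rP ∨ c = rQ ∨ c = sig := by simpa [DNULA, Design.suppN, Design.suppP] using hc
    rcases hc' with rfl | rfl | rfl <;> fin_cases f <;> exact ⟨by decide, by decide⟩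
  · intro c hN hP
    have h1 : c = rP ∨ c = rQ := by simpa [DNULA, Design.suppN] using hN
    have h2 : c = sig := by simpa [DNULA, Design.suppP] using hP
    rcases h1 with rfl | rfl
    · exact absurd (congrFun h2 3) (by decide)
    · exact absurd (congrFun h2 3) (by decide)
  · intro c hc f
    have hc' : c = rP ∨ c = rR ∨ c = sig := by simpa [DNULB, Design.suppN, Design.suppP] using hc
    rcases hc' with rfl | rfl | rfl <;> fin_cases f <;> exact ⟨by decide, by decide⟩
  · intro c hN hP
    have h1 : c = rP ∨ c = rR := by simpa [DNULB, Design.suppN] using hN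
    have h2 : c = sig := by simpa [DNULB, Design.suppP] using hP
    rcases h1 with rfl | rfl
    · exact absurd (congrFun h2 3) (by decide)
    · exact absurd (congrFun h2 3) (by decide)

/-- **SUMMARY OF THE TYPED READINGS** (memo v1.2 §4bis): on one-column toys the slot-rank row agrees with LAW PP in every instance and the
leg-surplus row is strictly weaker (MIX-B, DMIX, DNULA pass LEG, fail RHO, are PP-dirty). -/
theorem rho_agrees_with_pp_on_toys :
    (¬ HallPlusRhoUp MIXB ∧ ¬ PPClean weakB MIXB) ∧ (HallPlusRhoUp MIXA ∧ PPClean weakB MIXA) ∧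
    (¬ HallPlusRhoUp DMIX ∧ ¬ PPClean weakB DMIX) ∧ (HallPlusRhoUp DMIX2 ∧ PPClean weakB DMIX2) ∧
    (¬ HallPlusRhoUp DNULA ∧ ¬ PPClean weakB DNULA) ∧ (HallPlusRhoUp DNULB ∧ PPClean weakB DNULB) ∧
    (HallPlusLegUp MIXB ∧ HallPlusLegUp DMIX ∧ HallPlusLegUp DNULA) :=
  ⟨⟨not_hallPlusRhoUp_MIXB, rho_row_separates_MIXB.2.2⟩, ⟨hallPlusRhoUp_MIXA.2, MIXA_pp⟩, ⟨DMIX_rho.2.1, DMIX_rho.2.2⟩,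
    ⟨DMIX2_rho.2.1, DMIX2_rho.2.2⟩, ⟨DNULA_rho.2.1, DNULA_rho.2.2⟩, ⟨DNULB_rho.2.1, DNULB_rho.2.2⟩,
    ⟨hallPlusLegUp_MIXB, hallPlusLegUp_DMIX, hallPlusLegUp_DNULA⟩⟩

end Summit.HodgeConjecture.HodgeConjecture.Cruxes.BlochSeedDiscOne.PortHallRho
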